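import Literature.AlgebraicGeometry.AbelianSchemes.AbelianSchemeLiftOfClassZeroQuot
import Literature.AlgebraicGeometry.AbelianSchemes.AbelianSchemeOverField
import Literature.AlgebraicGeometry.Deformation.SmoothLiftAtlasRefinementClassQuot
import Literature.AlgebraicGeometry.Deformation.SmoothLiftAtlasChartChangeClassQuot
import Literature.AlgebraicGeometry.Morphisms.PrincipalAffineCoverBasicOpenRefinement
import Literature.AlgebraicGeometry.Morphisms.CechModuleH2RefinementInjective
import Literature.AlgebraicGeometry.Motives.AbelianVarietyTangentSheafFree
import Literature.AlgebraicGeometry.Modules.FlatteningStratificationDecomposition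
import HarnessLib

/-!
# The lift obstruction of an abelian scheme vanishes as soon as ONE lifted atlas has κ-class zero
# ([Oort1971] §2.2: the obstruction `D(X′; R → R′)` is well defined; Hartshorne, *Deformation Theory*, proof of Thm. 10.2 (a))

Layer `Literature/AlgebraicGeometry/AbelianSchemes`, namespace `Literature.AlgebraicGeometry.AbelianSchemes.AbelianSchemeOver`.
PROOF FILE, THEOREMS ONLY (no definition, no instance, no notation, no named fact, no `sorry`).  Cell `hodgecm-mathlib`, P6
sub-desk P6b, deal (vii-g) «ONE-ATLAS CRITERION ∕ κ-CLASS CANONICITY ASSEMBLER» 2026-09-02T20:31:55Z (LA1-p02 (g7); count-neutral ★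
capital on `--supports stmt-HodgeConjecture-24832`).  It sits next to ★ (D) `AbelianLiftObstructionClass` and speaks ITS letters.

THE PRINT.  [Oort1971, §2.2, pp. 277–279]: the obstruction `D(X′; R → R′) ∈ H²(X_k, Θ) ⊗ J` is computed on a lifted affine atlas as the
class of the triple discrepancies, and it is an invariant of `X′` and `R → R′` alone — i.e. independent of the atlas, of the local lifts and of
the gluings chosen; hence `D = 0` as soon as it is `0` for ONE atlas.  [Hartshorne2010, Thm. 10.2 (a), proof, p. 81]: «On the fourfold
intersection, these agree, so we get an obstruction `δ₃ ∈ H²(X₀, T⁰_{X₀} ⊗ J)`» (one class, whatever the cover).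

* §1 `exists_liftAtlasDatum_classZero_of_liftObstructionVanishes` — (g2 «→»): an abelian scheme `X₀` over `Spec (A⧸J)` (`A` Artin
  local, `J` principal small) HAS a datum of the ★ (D) letters (finite principal affine cover, standard smooth flat charts, reduction-compatible
  gluings, the closed-fibre layer `π = pr₁^♯` on the canonical closed fibre, face readings, a closed Čech 2-cochain representing them) —
  the construction of ★ FC-2 §2b (`exists_abelianLift_of_classZero`) verbatim: ★ §2a cover → ★ (ζ) `exists_atlas` → ★ (vii-c)
  `exists_closedFibreMaps_atlas` → ★ (c1) `existsUnique_reading_discrepancy` → ★ (vii) `exists_cochain_rep` → ★ (vii-b)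
  `cechMD2_eq_zero_of_atlas`; under `LiftObstructionVanishes` its class is `0`.
* §2 **`liftObstructionVanishes_of_atlas_classZero`** — (g1): if ONE such datum has class `[o] = 0`, then `LiftObstructionVanishes hJ hmJ φ X₀`
  (EVERY datum has class `0`).  Road: given a second datum on `V′`, refine both to the common doubly-principal refinement `W` of `V, V′`
  (★ `Morphisms.exists_finite_principal_affine_cover_basicOpen_refinement₂`, re-indexed by `Fin m`); the restricted data are again data of
  the letters with cochains `refineC2 τ o`, `refineC2 τ′ o′` (★ (vii-e) `SmoothLiftAtlasRefinementQuot`); on `W` the class does not depend on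
  the charts ∕ gluings ∕ readings (★ (vii-f) `SmoothLiftAtlasChartChangeClassQuot`), so `[refineC2 τ′ o′] = [refineC2 τ o] = 0`; and
  `Ȟ²(pr₁⁻¹𝒱′; 𝒯) → Ȟ²(pr₁⁻¹𝒲; 𝒯)` is injective for the AFFINE trace cover `pr₁⁻¹V′` and the affine-localizing `𝒯_{X_κ/κ}`
  (★ `Morphisms.CechMH2.mk_eq_zero_of_refineMC2_mem_cechMB2_of_isAffineOpen`; `𝒯` finite locally free on the abelian variety `X_κ`,
  ★ `Motives.AbelianVariety.isFiniteLocallyFree_tangentSheaf`).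
* §3 `liftObstructionVanishes_iff_exists_atlas_classZero` — (g2): `LiftObstructionVanishes hJ hmJ φ X₀ ↔ ∃ ONE datum with class 0`
  (its `.mpr` is the `∃`-form of §2).

NOT in this file: naturality of the class under an isomorphism `σ : X₀ ≅ X₀′` ((vii-d)) and anything `[n]^*` ((U-ab) proper).
HC_CM is proved only modulo the printed citations until rung 0 closes; nothing here bears on a summit statement.

## References
* [Oort1971] F. Oort, *Finite group schemes, local moduli for abelian varieties, and lifting problems*, Compositio Math. 23 (1971), §2.2
  (pp. 277–280), Theorem (2.2.1) (p. 273).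
* [Hartshorne2010] R. Hartshorne, *Deformation Theory*, GTM 257, Springer (2010): Thm. 10.2 (a) and its proof (p. 81).
* [GortzWedhorn2023] U. Görtz, T. Wedhorn, *Algebraic Geometry II: Cohomology of Schemes* (2023): Lemma 22.1 (p. 233), Thm. 22.9 (p. 236).
-/

noncomputable section

-- `TopCat.Presheaf`/`TopCat.Sheaf` and Mathlib's `Over` API are stated across semireducible wrappers.
set_option backward.isDefEq.respectTransparency false

open CategoryTheory CategoryTheory.Limits AlgebraicGeometry TopologicalSpace Opposite
open scoped TensorProduct
open Literature.AlgebraicGeometry.Morphisms Literature.AlgebraicGeometry.HodgeTheory Literature.AlgebraicGeometry.Modules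
  Literature.AlgebraicGeometry.Motives
open Literature.AlgebraicGeometry.Deformation.AtlasQuot Literature.AlgebraicGeometry.Deformation.CanonicalLiftQuot
  Literature.AlgebraicGeometry.Deformation.LiftAtlasAssemblyQuot Literature.AlgebraicGeometry.Deformation.LiftableCoverQuot
  Literature.AlgebraicGeometry.Deformation.LiftObstructionCocycleQuot Literature.AlgebraicGeometry.Deformation.ExtensionAutomorphismsQuot
  Literature.AlgebraicGeometry.Deformation.LiftObstructionCechClassQuot Literature.AlgebraicGeometry.Deformation.LiftObstructionClassAtlasQuot
  Literature.AlgebraicGeometry.Deformation.LiftClosedFibreDictionaryQuot Literature.AlgebraicGeometry.Deformation.LiftOfClassZeroAtlasQuot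

namespace Literature.AlgebraicGeometry.AbelianSchemes.AbelianSchemeOver

variable {A : Type} [CommRing A] [IsArtinianRing A] [IsLocalRing A] {J : Ideal A}

/-! ## §1 Every abelian scheme over `A⧸J` has a datum of the (D) letters; under `LiftObstructionVanishes` its class is `0` -/

set_option maxHeartbeats 400000 in -- the 28-letter `∃` statement + FC-2 §2b's construction: ≈ 1.3× the default budget
/-- **(g2 «→») A datum of the letters with class zero, from `LiftObstructionVanishes`.**  `A` Artin local, `J` principal small
(`J ≠ ⊤`, `𝔪·J = 0`, `φ : J ≅ κ(A)`), `X₀` an abelian scheme over `Spec (A⧸J)`.  There is a lifted atlas `(n, V, c, P, r, ψ)` of `X₀` (★ §2a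
cover, ★ (ζ) `exists_atlas`), the closed-fibre layer `π = pr₁^♯` on the canonical closed fibre `X₀ ×_{A⧸J} κ(A)` (★ (vii-c)), face readings `δ`
(★ (c1)) and a closed Čech 2-cochain `o` of `𝒯_{X_κ/κ}` on `pr₁⁻¹V` representing them (★ (vii), ★ (vii-b)); if the lift obstruction vanishes, the
class of `o` is `0`. [cite: Oort1971, §2.2 (pp. 277–280)] [cite: Hartshorne2010, Thm. 10.2 (a) (proof), p. 81] -/
theorem exists_liftAtlasDatum_classZero_of_liftObstructionVanishes (hJ : J ≠ ⊤) (hmJ : IsLocalRing.maximalIdeal A * J = ⊥)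
    (φ : ↥J ≃ₗ[A] IsLocalRing.ResidueField A) (X₀ : AbelianSchemeOver (Spec (.of (A ⧸ J))))
    (hvan : LiftObstructionVanishes hJ hmJ φ X₀) :
    letI : ∀ W : X₀.X.left.Opens, Algebra A Γ(X₀.X.left, W) := fun W =>
      (((Scheme.ΓSpecIso (.of (A ⧸ J))).inv ≫ X₀.X.hom.appLE ⊤ W le_top).hom.comp (Ideal.Quotient.mk J)).toAlgebra
    ∃ (n : ℕ) (V : Fin n → X₀.X.left.affineOpens) (c : (a b : Fin n) → Γ(X₀.X.left, (V a).1))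
      (P : Fin n → Type) (_ : ∀ a, CommRing (P a)) (_ : ∀ a, Algebra A (P a)) (_ : ∀ a, Algebra.IsStandardSmooth A (P a))
      (_ : ∀ a, Module.Flat A (P a))
      (r : (a : Fin n) → P a →ₐ[A] Γ(X₀.X.left, (V a).1))
      (ψ : (a b : Fin n) → chartLift V r a (inf_le_left : (V a).1 ⊓ (V b).1 ≤ (V a).1) ≃ₐ[A]
        chartLift V r b (inf_le_right : (V a).1 ⊓ (V b).1 ≤ (V b).1))
      (_ : ⨆ a, (V a).1 = ⊤) (hc : ∀ a b, (V a).1 ⊓ (V b).1 = X₀.X.left.basicOpen (c a b))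
      (hr : ∀ a, Function.Surjective (r a)) (hkr : ∀ a, RingHom.ker (r a) = J.map (algebraMap A (P a)))
      (hψ : ∀ a b x, reduction (r b) (res (inf_le_right : (V a).1 ⊓ (V b).1 ≤ (V b).1))
          (halg_of_structureMorphism X₀.X.hom _ _ _) (ψ a b x) =
        reduction (r a) (res (inf_le_left : (V a).1 ⊓ (V b).1 ≤ (V a).1)) (halg_of_structureMorphism X₀.X.hom _ _ _) x)
      (_ : ∀ W : (closedFibre hJ X₀).X.left.Opens, Algebra A Γ((closedFibre hJ X₀).X.left, W))
      (π : (W : X₀.X.left.Opens) → Γ(X₀.X.left, W) →ₐ[A]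
        Γ((closedFibre hJ X₀).X.left, (closedFibreι hJ X₀) ⁻¹ᵁ W))
      (hπ : ∀ (a : Fin n) (W : X₀.X.left.Opens), W ≤ (V a).1 → (∃ q : Γ(X₀.X.left, (V a).1), W = X₀.X.left.basicOpen q) →
        Function.Surjective (π W) ∧ RingHom.ker (π W) = (IsLocalRing.maximalIdeal A).map (algebraMap A Γ(X₀.X.left, W)))
      (δ : (a b d : Fin n) → Derivation A
        Γ((closedFibre hJ X₀).X.left, (closedFibreι hJ X₀) ⁻¹ᵁ ((V a).1 ⊓ (V b).1 ⊓ (V d).1))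
        (Γ((closedFibre hJ X₀).X.left, (closedFibreι hJ X₀) ⁻¹ᵁ ((V a).1 ⊓ (V b).1 ⊓ (V d).1)) ⊗[A] ↥J))
      (_ : ∀ a b d, readingAut (halg_of_structureMorphism X₀.X.hom) (LiftedLaw.isNilpotent_of_ne_top hJ) V r hr hkr
          (IsLocalRing.maximalIdeal A) π hπ hmJ (IsLocalRing.le_maximalIdeal hJ) a (inf_le_left.trans inf_le_left)
          ⟨_, inf₃_eq_basicOpen₁ V c hc a b d⟩ (δ a b d) =
        disc (halg_of_structureMorphism X₀.X.hom) (LiftedLaw.isNilpotent_of_ne_top hJ) V c hc r hr hkr ψ hψ a b d)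
      (_ : ∀ (W : (closedFibre hJ X₀).X.left.Opens) (a : A), algebraMap A Γ((closedFibre hJ X₀).X.left, W) a =
        (constToPresheaf (closedFibre hJ X₀).X).app (op W) (algebraMap A (IsLocalRing.ResidueField A) a))
      (_ : ∀ (W : X₀.X.left.Opens) (x : Γ(X₀.X.left, W)), π W x = (closedFibreι hJ X₀).app W x)
      (_ : ∀ a, IsAffineOpen ((closedFibreι hJ X₀) ⁻¹ᵁ (V a).1))
      (_ : ∀ ⦃W W' : X₀.X.left.Opens⦄ (h : W' ≤ W) (x : Γ(X₀.X.left, W)),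
        (closedFibre hJ X₀).X.left.presheaf.map
          (homOfLE ((closedFibreι hJ X₀).preimage_mono h)).op (π W x) = π W' (res h x))
      (o : CechMC2 (closedFibre hJ X₀).X.hom (tangentSheaf (closedFibre hJ X₀).X) (fun a => (closedFibreι hJ X₀) ⁻¹ᵁ (V a).1))
      (_ : ∀ (a b d : Fin n) (x : Γ((closedFibre hJ X₀).X.left, (closedFibreι hJ X₀) ⁻¹ᵁ (V a).1 ⊓ (closedFibreι hJ X₀) ⁻¹ᵁ (V b).1 ⊓ (closedFibreι hJ X₀) ⁻¹ᵁ (V d).1)),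
        δ a b d x = (show Γ((closedFibre hJ X₀).X.left, (closedFibreι hJ X₀) ⁻¹ᵁ (V a).1 ⊓ (closedFibreι hJ X₀) ⁻¹ᵁ (V b).1 ⊓ (closedFibreι hJ X₀) ⁻¹ᵁ (V d).1) from
          appLE (o a b d) (𝟙 _) (dSection (closedFibre hJ X₀).X _ x)) ⊗ₜ φ.symm 1)
      (ho₂ : o ∈ cechMZ2 (closedFibre hJ X₀).X.hom (tangentSheaf (closedFibre hJ X₀).X) (fun a => (closedFibreι hJ X₀) ⁻¹ᵁ (V a).1)),
      CechMH2.mk (closedFibre hJ X₀).X.hom (tangentSheaf (closedFibre hJ X₀).X) (fun a => (closedFibreι hJ X₀) ⁻¹ᵁ (V a).1) ⟨o, ho₂⟩ = 0 := by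
  -- THE CONSTRUCTION OF ★ FC-2 §2b (`exists_abelianLift_of_classZero`, A-p12 (g31)) VERBATIM, returned as data instead of consumed.
  -- the section rings of `X₀` as `A`-algebras through `X₀ → Spec (A⧸J) → Spec A`
  letI instΓ₀ : ∀ W : X₀.X.left.Opens, Algebra A Γ(X₀.X.left, W) := fun W =>
    (((Scheme.ΓSpecIso (.of (A ⧸ J))).inv ≫ X₀.X.hom.appLE ⊤ W le_top).hom.comp (Ideal.Quotient.mk J)).toAlgebra
  have halg₀ := halg_of_structureMorphism (A' := A) X₀.X.hom
  have halg₀' : ∀ (W : X₀.X.left.Opens) (a : A), algebraMap A Γ(X₀.X.left, W) a =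
      (X₀.X.hom.appLE ⊤ W le_top) ((Scheme.ΓSpecIso (.of (A ⧸ J))).inv (Ideal.Quotient.mk J a)) := fun W a => rfl
  have hJnil : IsNilpotent J := LiftedLaw.isNilpotent_of_ne_top hJ
  haveI : Smooth X₀.X.hom := X₀.isSmooth
  haveI : CompactSpace X₀.X.left := by
    haveI := X₀.isProper
    exact QuasiCompact.compactSpace_of_compactSpace X₀.X.hom
  -- the residue model `ρ : A ⧸ J ↠ κ(A)` (kernel `𝔪_A (A⧸J)`, nilpotent)
  let ρ : A ⧸ J →+* IsLocalRing.ResidueField A := Ideal.Quotient.factor (IsLocalRing.le_maximalIdeal hJ)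
  have hκ : Function.Surjective (algebraMap A (IsLocalRing.ResidueField A)) := IsLocalRing.residue_surjective
  have hφfac : ∀ a : A, ρ (Ideal.Quotient.mk J a) = algebraMap A (IsLocalRing.ResidueField A) a := fun a => rfl
  have h𝔪 : RingHom.ker (algebraMap A (IsLocalRing.ResidueField A)) = IsLocalRing.maximalIdeal A :=
    IsLocalRing.ker_residue
  have hρ : Function.Surjective ρ := Ideal.Quotient.factor_surjective _
  have hρnil : IsNilpotent (RingHom.ker ρ) := by
    rw [← map_mk_ker_eq_ker J ρ hφfac, h𝔪]
    obtain ⟨k, hk⟩ := LiftedLaw.isNilpotent_of_ne_top (IsLocalRing.maximalIdeal.isMaximal A).ne_top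
    exact ⟨k, by rw [← Ideal.map_pow, hk, Ideal.zero_eq_bot, Ideal.map_bot, Ideal.zero_eq_bot]⟩
  -- ★ §2a: a finite principal affine cover of `X₀`; ★ (ζ): the lifted atlas with STANDARD SMOOTH charts
  obtain ⟨ι₀, _, U, b, hU, hb⟩ := exists_principal_affine_cover_of_surjective_field ρ hρ hρnil X₀
  obtain ⟨n, V, c, τ, P, _, _, _, r, ψ, hV, hc, -, hr, hkr, hψ, -, -⟩ :=
    exists_atlas (A' := A) hJnil X₀.X.hom U b hb hU
  -- the canonical closed fibre `X_κ := X₀ ×_{A⧸J} κ(A)`, its sections as `A`-algebras through `κ(A)`, and the ★ (vii-c) dictionary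
  letI instΓκ : ∀ W : (closedFibre hJ X₀).X.left.Opens, Algebra A Γ((closedFibre hJ X₀).X.left, W) := fun W =>
    (((constToPresheaf (closedFibre hJ X₀).X).app (op W)).hom.comp (algebraMap A (IsLocalRing.ResidueField A))).toAlgebra
  have halgκ : ∀ (W : (closedFibre hJ X₀).X.left.Opens) (a : A), algebraMap A Γ((closedFibre hJ X₀).X.left, W) a =
      (constToPresheaf (closedFibre hJ X₀).X).app (op W) (algebraMap A (IsLocalRing.ResidueField A) a) := fun W a => rfl
  have H : IsPullback (closedFibreι hJ X₀) (closedFibre hJ X₀).X.hom X₀.X.hom (residueBaseMap hJ) :=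
    IsPullback.of_hasPullback X₀.X.hom (residueBaseMap hJ)
  have hcf := exists_closedFibreMaps_atlas hκ J ρ hφfac X₀.X.hom
    (closedFibreι hJ X₀) H halg₀' halgκ (IsLocalRing.maximalIdeal A) h𝔪 V
  rcases hcf with ⟨hiV, π, hπi, hπ, hπnat⟩
  -- the face readings of the atlas (★ (c1) `existsUnique_reading_discrepancy` on the canonical reductions)
  have hδex : ∀ a b d : Fin n, ∃ δ : Derivation A Γ((closedFibre hJ X₀).X.left, closedFibreι hJ X₀ ⁻¹ᵁ ((V a).1 ⊓ (V b).1 ⊓ (V d).1))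
      (Γ((closedFibre hJ X₀).X.left, closedFibreι hJ X₀ ⁻¹ᵁ ((V a).1 ⊓ (V b).1 ⊓ (V d).1)) ⊗[A] ↥J),
      readingAut halg₀ hJnil V r hr hkr (IsLocalRing.maximalIdeal A) π hπ hmJ (IsLocalRing.le_maximalIdeal hJ) a
        (inf_le_left.trans inf_le_left : (V a).1 ⊓ (V b).1 ⊓ (V d).1 ≤ (V a).1) ⟨_, inf₃_eq_basicOpen₁ V c hc a b d⟩ δ =
      disc halg₀ hJnil V c hc r hr hkr ψ hψ a b d := fun a b d => by
    have ha' : (V a).1 ⊓ (V b).1 ⊓ (V d).1 ≤ (V a).1 := inf_le_left.trans inf_le_left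
    have hb' : (V a).1 ⊓ (V b).1 ⊓ (V d).1 ≤ (V b).1 := inf_le_left.trans inf_le_right
    have hd' : (V a).1 ⊓ (V b).1 ⊓ (V d).1 ≤ (V d).1 := inf_le_right
    have pa : ∃ q : Γ(X₀.X.left, (V a).1), (V a).1 ⊓ (V b).1 ⊓ (V d).1 = X₀.X.left.basicOpen q := ⟨_, inf₃_eq_basicOpen₁ V c hc a b d⟩
    have pb : ∃ q : Γ(X₀.X.left, (V b).1), (V a).1 ⊓ (V b).1 ⊓ (V d).1 = X₀.X.left.basicOpen q := ⟨_, inf₃_eq_basicOpen₂ V c hc a b d⟩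
    have pd : ∃ q : Γ(X₀.X.left, (V d).1), (V a).1 ⊓ (V b).1 ⊓ (V d).1 = X₀.X.left.basicOpen q := ⟨_, inf₃_eq_basicOpen₃ V c hc a b d⟩
    haveI := Deformation.CanonicalLiftQuot.flat (r a) (Deformation.AtlasQuot.res ha')
    obtain ⟨ε, hε, -⟩ := existsUnique_reading_discrepancy (IsLocalRing.maximalIdeal A) J hmJ (IsLocalRing.le_maximalIdeal hJ)
      (fibreRed halg₀ V r π a ha') (fibreRed_surjective halg₀ hJnil V r hr hkr (IsLocalRing.maximalIdeal A) π hπ a ha' pa)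
      (ker_fibreRed halg₀ hJnil V r hr hkr (IsLocalRing.maximalIdeal A) π hπ (IsLocalRing.le_maximalIdeal hJ) a ha' pa)
      (reduction (r a) (Deformation.AtlasQuot.res ha') (halg₀ _ _ _)) (reduction (r b) (Deformation.AtlasQuot.res hb') (halg₀ _ _ _))
      (reduction (r d) (Deformation.AtlasQuot.res hd') (halg₀ _ _ _))
      (ker_reduction hJnil (r a) (hr a) (hkr a) (Deformation.AtlasQuot.res ha') (halg₀ _ _ _)
        ((V a).2.isLocalization_of_eq_basicOpen _ (homOfLE ha') (inf₃_eq_basicOpen₁ V c hc a b d)))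
      (gluingOn halg₀ hJnil V r hr hkr ψ hψ a b _ ha' hb' pa pb) (gluingOn halg₀ hJnil V r hr hkr ψ hψ b d _ hb' hd' pb pd)
      (gluingOn halg₀ hJnil V r hr hkr ψ hψ a d _ ha' hd' pa pd)
      (reduction_gluingOn halg₀ hJnil V r hr hkr ψ hψ a b _ ha' hb' pa pb) (reduction_gluingOn halg₀ hJnil V r hr hkr ψ hψ b d _ hb' hd' pb pd)
      (reduction_gluingOn halg₀ hJnil V r hr hkr ψ hψ a d _ ha' hd' pa pd)
    exact ⟨ε, hε⟩
  choose δ hδ using hδex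
  -- the Čech 2-cochain of the readings on the trace cover, a cocycle (★ (vii), ★ (vii-b))
  have hrep := exists_cochain_rep hκ halgκ J φ
    (fun a => (⟨closedFibreι hJ X₀ ⁻¹ᵁ (V a).1, hiV a⟩ : (closedFibre hJ X₀).X.left.affineOpens))
    (fun a b => (closedFibreι hJ X₀).app (V a).1 (c a b)) (preimage_inf_eq_basicOpen V c hc (closedFibreι hJ X₀) hiV) δ
  rcases hrep with ⟨o, ho⟩
  have ho₂ : o ∈ cechMZ2 (closedFibre hJ X₀).X.hom (tangentSheaf (closedFibre hJ X₀).X) (fun a => closedFibreι hJ X₀ ⁻¹ᵁ (V a).1) :=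
    (mem_cechMZ2_iff _ _ _ o).2 (cechMD2_eq_zero_of_atlas hκ halgκ J φ halg₀ hJnil V c hc r hr hkr (closedFibreι hJ X₀) hiV
      (IsLocalRing.maximalIdeal A) hmJ (IsLocalRing.le_maximalIdeal hJ) π hπ hπnat ψ hψ δ hδ ho)
  -- THE DATUM, and its class under the contract
  exact ⟨n, V, c, P, inferInstance, inferInstance, inferInstance, inferInstance, r, ψ, hV, hc, hr, hkr, hψ, instΓκ, π, hπ, δ, hδ,
    halgκ, hπi, hiV, hπnat, o, ho, ho₂, hvan n V c P r ψ hV hc hr hkr hψ π hπ δ hδ halgκ hπi hiV hπnat o ho ho₂⟩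

/-! ## §2 (g1) ONE atlas of class zero ⇒ the lift obstruction vanishes -/

set_option maxHeartbeats 400000 in -- two 28-letter data, their restrictions to the common refinement, (vii-e) ×4 + (vii-f): ≈ 1.6× budget
/-- **(g1) THE ONE-ATLAS CRITERION.**  `A` Artin local, `J` principal small (`J ≠ ⊤`, `𝔪·J = 0`, `φ : J ≅ κ(A)`), `X₀` an abelian scheme over
`Spec (A⧸J)`.  If ONE datum of the ★ (D) letters — a lifted atlas `(n, V, c, P, r, ψ)` (finite principal affine cover, standard smooth flat charts
`r a : P a ↠ Γ(X₀, V a)` with `ker = J·P a`, reduction-compatible gluings), the closed-fibre layer `π` on the canonical closed fibre pinned to `pr₁^♯`,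
face readings `δ`, and a closed Čech 2-cochain `o` of `𝒯_{X_κ/κ}` on `pr₁⁻¹V` representing them — has class `[o] = 0`, then the lift obstruction of
`X₀` VANISHES: every such datum has class `0`.  (The class is independent of the atlas: common doubly-principal refinement ★
`exists_finite_principal_affine_cover_basicOpen_refinement₂`, restriction ★ (vii-e), chart-independence on a fixed cover ★ (vii-f), injectivity of
`Ȟ²` under refinement of an affine cover ★ `CechMH2.mk_eq_zero_of_refineMC2_mem_cechMB2_of_isAffineOpen`.)
[cite: Oort1971, §2.2 (pp. 277–280)] [cite: Hartshorne2010, Thm. 10.2 (a) (proof), p. 81] [cite: GortzWedhorn2023, Thm. 22.9 (p. 236)] -/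
theorem liftObstructionVanishes_of_atlas_classZero (hJ : J ≠ ⊤) (hmJ : IsLocalRing.maximalIdeal A * J = ⊥)
    (φ : ↥J ≃ₗ[A] IsLocalRing.ResidueField A) (X₀ : AbelianSchemeOver (Spec (.of (A ⧸ J)))) :
    letI : ∀ W : X₀.X.left.Opens, Algebra A Γ(X₀.X.left, W) := fun W =>
      (((Scheme.ΓSpecIso (.of (A ⧸ J))).inv ≫ X₀.X.hom.appLE ⊤ W le_top).hom.comp (Ideal.Quotient.mk J)).toAlgebra
    ∀ (n : ℕ) (V : Fin n → X₀.X.left.affineOpens) (c : (a b : Fin n) → Γ(X₀.X.left, (V a).1))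
      (P : Fin n → Type) [∀ a, CommRing (P a)] [∀ a, Algebra A (P a)] [∀ a, Algebra.IsStandardSmooth A (P a)]
      [∀ a, Module.Flat A (P a)]
      (r : (a : Fin n) → P a →ₐ[A] Γ(X₀.X.left, (V a).1))
      (ψ : (a b : Fin n) → chartLift V r a (inf_le_left : (V a).1 ⊓ (V b).1 ≤ (V a).1) ≃ₐ[A]
        chartLift V r b (inf_le_right : (V a).1 ⊓ (V b).1 ≤ (V b).1))
      (hV : ⨆ a, (V a).1 = ⊤) (hc : ∀ a b, (V a).1 ⊓ (V b).1 = X₀.X.left.basicOpen (c a b))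
      (hr : ∀ a, Function.Surjective (r a)) (hkr : ∀ a, RingHom.ker (r a) = J.map (algebraMap A (P a)))
      (hψ : ∀ a b x, reduction (r b) (res (inf_le_right : (V a).1 ⊓ (V b).1 ≤ (V b).1))
          (halg_of_structureMorphism X₀.X.hom _ _ _) (ψ a b x) =
        reduction (r a) (res (inf_le_left : (V a).1 ⊓ (V b).1 ≤ (V a).1)) (halg_of_structureMorphism X₀.X.hom _ _ _) x)
      [∀ W : (closedFibre hJ X₀).X.left.Opens, Algebra A Γ((closedFibre hJ X₀).X.left, W)]
      (π : (W : X₀.X.left.Opens) → Γ(X₀.X.left, W) →ₐ[A]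
        Γ((closedFibre hJ X₀).X.left, (closedFibreι hJ X₀) ⁻¹ᵁ W))
      (hπ : ∀ (a : Fin n) (W : X₀.X.left.Opens), W ≤ (V a).1 → (∃ q : Γ(X₀.X.left, (V a).1), W = X₀.X.left.basicOpen q) →
        Function.Surjective (π W) ∧ RingHom.ker (π W) = (IsLocalRing.maximalIdeal A).map (algebraMap A Γ(X₀.X.left, W)))
      (δ : (a b d : Fin n) → Derivation A
        Γ((closedFibre hJ X₀).X.left, (closedFibreι hJ X₀) ⁻¹ᵁ ((V a).1 ⊓ (V b).1 ⊓ (V d).1))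
        (Γ((closedFibre hJ X₀).X.left, (closedFibreι hJ X₀) ⁻¹ᵁ ((V a).1 ⊓ (V b).1 ⊓ (V d).1)) ⊗[A] ↥J))
      (hδ : ∀ a b d, readingAut (halg_of_structureMorphism X₀.X.hom) (LiftedLaw.isNilpotent_of_ne_top hJ) V r hr hkr
          (IsLocalRing.maximalIdeal A) π hπ hmJ (IsLocalRing.le_maximalIdeal hJ) a (inf_le_left.trans inf_le_left)
          ⟨_, inf₃_eq_basicOpen₁ V c hc a b d⟩ (δ a b d) =
        disc (halg_of_structureMorphism X₀.X.hom) (LiftedLaw.isNilpotent_of_ne_top hJ) V c hc r hr hkr ψ hψ a b d)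
      (halgκ : ∀ (W : (closedFibre hJ X₀).X.left.Opens) (a : A), algebraMap A Γ((closedFibre hJ X₀).X.left, W) a =
        (constToPresheaf (closedFibre hJ X₀).X).app (op W) (algebraMap A (IsLocalRing.ResidueField A) a))
      (hπi : ∀ (W : X₀.X.left.Opens) (x : Γ(X₀.X.left, W)), π W x = (closedFibreι hJ X₀).app W x)
      (hiV : ∀ a, IsAffineOpen ((closedFibreι hJ X₀) ⁻¹ᵁ (V a).1))
      (hπnat : ∀ ⦃W W' : X₀.X.left.Opens⦄ (h : W' ≤ W) (x : Γ(X₀.X.left, W)),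
        (closedFibre hJ X₀).X.left.presheaf.map
          (homOfLE ((closedFibreι hJ X₀).preimage_mono h)).op (π W x) = π W' (res h x))
      (o : CechMC2 (closedFibre hJ X₀).X.hom (tangentSheaf (closedFibre hJ X₀).X) (fun a => (closedFibreι hJ X₀) ⁻¹ᵁ (V a).1))
      (ho : ∀ (a b d : Fin n) (x : Γ((closedFibre hJ X₀).X.left, (closedFibreι hJ X₀) ⁻¹ᵁ (V a).1 ⊓ (closedFibreι hJ X₀) ⁻¹ᵁ (V b).1 ⊓ (closedFibreι hJ X₀) ⁻¹ᵁ (V d).1)),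
        δ a b d x = (show Γ((closedFibre hJ X₀).X.left, (closedFibreι hJ X₀) ⁻¹ᵁ (V a).1 ⊓ (closedFibreι hJ X₀) ⁻¹ᵁ (V b).1 ⊓ (closedFibreι hJ X₀) ⁻¹ᵁ (V d).1) from
          appLE (o a b d) (𝟙 _) (dSection (closedFibre hJ X₀).X _ x)) ⊗ₜ φ.symm 1)
      (ho₂ : o ∈ cechMZ2 (closedFibre hJ X₀).X.hom (tangentSheaf (closedFibre hJ X₀).X) (fun a => (closedFibreι hJ X₀) ⁻¹ᵁ (V a).1)),
      CechMH2.mk (closedFibre hJ X₀).X.hom (tangentSheaf (closedFibre hJ X₀).X) (fun a => (closedFibreι hJ X₀) ⁻¹ᵁ (V a).1) ⟨o, ho₂⟩ = 0 →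
      LiftObstructionVanishes hJ hmJ φ X₀ := by
  -- the section rings of `X₀` as `A`-algebras through `X₀ → Spec (A⧸J) → Spec A` (the statement's `letI`, re-installed as an instance)
  letI instΓ₀ : ∀ W : X₀.X.left.Opens, Algebra A Γ(X₀.X.left, W) := fun W =>
    (((Scheme.ΓSpecIso (.of (A ⧸ J))).inv ≫ X₀.X.hom.appLE ⊤ W le_top).hom.comp (Ideal.Quotient.mk J)).toAlgebra
  intro n V c P _ _ _ _ r ψ hV hc hr hkr hψ instκ π hπ δ hδ halgκ hπi hiV hπnat o ho ho₂ h0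
    -- … and the letters of `LiftObstructionVanishes` for the SECOND datum:
    n' V' c' P' _ _ _ _ r' ψ' hV' hc' hr' hkr' hψ' instκ' π' hπ' δ' hδ' halgκ' hπi' hiV' hπnat' o' ho' ho₂'
  /- (0) THE CLOSED-FIBRE LAYERS OF THE TWO DATA COINCIDE: both `A`-algebra structures on the sections of the canonical closed fibre factor
  through its constants (`halgκ`, `halgκ'`), and both `π`, `π'` are pinned to `pr₁^♯` (`hπi`, `hπi'`). -/
  have hinst : instκ = instκ' := by
    funext U
    exact Algebra.algebra_ext _ _ fun a => (halgκ U a).trans (halgκ' U a).symm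
  subst hinst
  have hππ : π = π' := by
    funext U
    exact AlgHom.ext fun x => (hπi U x).trans (hπi' U x).symm
  subst hππ
  -- names
  have halg₀ := halg_of_structureMorphism (A' := A) X₀.X.hom
  have hJnil : IsNilpotent J := LiftedLaw.isNilpotent_of_ne_top hJ
  have hκ : Function.Surjective (algebraMap A (IsLocalRing.ResidueField A)) := IsLocalRing.residue_surjective
  haveI : Smooth X₀.X.hom := X₀.isSmooth
  haveI : CompactSpace X₀.X.left := by
    haveI := X₀.isProper
    exact QuasiCompact.compactSpace_of_compactSpace X₀.X.hom
  /- (1) THE COMMON DOUBLY-PRINCIPAL REFINEMENT `W` of `V` and `V'` (★ `Morphisms/PrincipalAffineCoverBasicOpenRefinement`), re-indexed by `Fin m`. -/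
  obtain ⟨T, _, Wt, cWt, τt, τt', at₁, at₂, hWt, hcWt, hWa, hWa'⟩ :=
    Morphisms.exists_finite_principal_affine_cover_basicOpen_refinement₂ V c hc hV V' hV'
  obtain ⟨m, ⟨e⟩⟩ := Finite.exists_equiv_fin T
  obtain ⟨W, cW, τ, τ', hW, hcW, hτ, pτ, hτ', pτ'⟩ : ∃ (W : Fin m → X₀.X.left.affineOpens) (cW : (j k : Fin m) → Γ(X₀.X.left, (W j).1))
      (τ : Fin m → Fin n) (τ' : Fin m → Fin n'),
      (⨆ j, (W j).1 = ⊤) ∧ (∀ j k, (W j).1 ⊓ (W k).1 = X₀.X.left.basicOpen (cW j k)) ∧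
      (∀ j, (W j).1 ≤ (V (τ j)).1) ∧ (∀ j, ∃ q : Γ(X₀.X.left, (V (τ j)).1), (W j).1 = X₀.X.left.basicOpen q) ∧
      (∀ j, (W j).1 ≤ (V' (τ' j)).1) ∧ (∀ j, ∃ q : Γ(X₀.X.left, (V' (τ' j)).1), (W j).1 = X₀.X.left.basicOpen q) := by
    refine ⟨fun j => Wt (e.symm j), fun j k => cWt (e.symm j) (e.symm k), fun j => τt (e.symm j), fun j => τt' (e.symm j),
      ?_, fun j k => hcWt _ _, fun j => ?_, fun j => ⟨at₁ _, hWa _⟩, fun j => ?_, fun j => ⟨at₂ _, hWa' _⟩⟩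
    · rw [← hWt]
      exact e.symm.iSup_comp (g := fun t => (Wt t).1)
    · rw [hWa]; exact X₀.X.left.basicOpen_le _
    · rw [hWa']; exact X₀.X.left.basicOpen_le _
  /- (2) THE TWO DATA RESTRICTED TO `W` (★ (vii-e) `SmoothLiftAtlasRefinement{,Class}Quot`): flat ∕ formally smooth restricted charts, and
  the restricted face readings `δ₁`, `δ₂` represented by the refined cochains `ρ_τ o`, `ρ_τ' o'` (`exists_faceReadings_refine_rep`, which builds
  the κ-side restriction maps from ★ (vii) `exists_algHom_res` + `hπnat`). -/
  haveI : ∀ j, Module.Flat A (chartLift V r (τ j) (hτ j)) := fun j => Deformation.CanonicalLiftQuot.flat _ _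
  haveI : ∀ j, Module.Flat A (chartLift V' r' (τ' j) (hτ' j)) := fun j => Deformation.CanonicalLiftQuot.flat _ _
  haveI : ∀ j, Algebra.FormallySmooth A (chartLift V' r' (τ' j) (hτ' j)) := fun j => Deformation.CanonicalLiftQuot.formallySmooth _ _
  obtain ⟨δ₁, hδ₁, ho₁⟩ := Deformation.AtlasRefinementQuot.exists_faceReadings_refine_rep (hκ := hκ) (halg := halgκ) (J := J) (φ := φ)
    (i := closedFibreι hJ X₀) (V := V) (c := c) (hc := hc) (hiV := hiV) (V' := W) (τ := τ) (hτ := hτ) (pτ := pτ) (c' := cW) (hc' := hcW)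
    (halg₀ := halg₀) (hJ := hJnil) (r := r) (hr := hr) (hkr := hkr) (ψ := ψ) (hψ := hψ) (𝔪 := IsLocalRing.maximalIdeal A) (h𝔪J := hmJ)
    (hJ𝔪 := IsLocalRing.le_maximalIdeal hJ) (π := π) (hπ := hπ) (hπnat := hπnat) (δ := δ) (hδ := hδ) (ho := ho)
  obtain ⟨δ₂, hδ₂, ho₂r⟩ := Deformation.AtlasRefinementQuot.exists_faceReadings_refine_rep (hκ := hκ) (halg := halgκ) (J := J) (φ := φ)
    (i := closedFibreι hJ X₀) (V := V') (c := c') (hc := hc') (hiV := hiV') (V' := W) (τ := τ') (hτ := hτ') (pτ := pτ') (c' := cW)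
    (hc' := hcW) (halg₀ := halg₀) (hJ := hJnil) (r := r') (hr := hr') (hkr := hkr') (ψ := ψ') (hψ := hψ') (𝔪 := IsLocalRing.maximalIdeal A)
    (h𝔪J := hmJ) (hJ𝔪 := IsLocalRing.le_maximalIdeal hJ) (π := π) (hπ := hπ') (hπnat := hπnat) (δ := δ') (hδ := hδ') (ho := ho')
  /- (3) ON `W` THE CLASS DOES NOT DEPEND ON THE CHARTS ∕ GLUINGS ∕ READINGS (★ (vii-f) `SmoothLiftAtlasChartChangeClassQuot`):
  `[ρ_τ' o'] = [ρ_τ o]`. -/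
  have hiW : ∀ j, IsAffineOpen ((closedFibreι hJ X₀) ⁻¹ᵁ (W j).1) := fun j =>
    Deformation.AtlasRefinementQuot.isAffineOpen_preimage_refine (i := closedFibreι hJ X₀) (V := V) (hiV := hiV) (V' := W) (τ := τ)
      (pτ := pτ) j
  have key := Deformation.AtlasChartChangeQuot.cechMH2_mk_eq_of_chartChange (J := J) (halg₀ := halg₀) (hJ := hJnil) (V := W) (c := cW)
    (hc := hcW) (r := Deformation.AtlasRefinementQuot.refineRed halg₀ V r W τ hτ)
    (hr := Deformation.AtlasRefinementQuot.refineRed_surjective halg₀ hJnil V r hr hkr W τ hτ pτ)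
    (hkr := Deformation.AtlasRefinementQuot.ker_refineRed halg₀ hJnil V r hr hkr W τ hτ pτ)
    (r' := Deformation.AtlasRefinementQuot.refineRed halg₀ V' r' W τ' hτ')
    (hr' := Deformation.AtlasRefinementQuot.refineRed_surjective halg₀ hJnil V' r' hr' hkr' W τ' hτ' pτ')
    (hkr' := Deformation.AtlasRefinementQuot.ker_refineRed halg₀ hJnil V' r' hr' hkr' W τ' hτ' pτ')
    (hκ := hκ) (halg := halgκ) (φ := φ) (i := closedFibreι hJ X₀) (hiV := hiW) (𝔪 := IsLocalRing.maximalIdeal A) (h𝔪J := hmJ)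
    (hJ𝔪 := IsLocalRing.le_maximalIdeal hJ) (π := π)
    (hπ := Deformation.AtlasRefinementQuot.hπ_refine V W τ hτ pτ (IsLocalRing.maximalIdeal A) π hπ) hπnat
    (Deformation.AtlasRefinementQuot.refineGluing halg₀ hJnil V r hr hkr ψ hψ W τ hτ pτ cW hcW)
    (Deformation.AtlasRefinementQuot.reduction_refineGluing halg₀ hJnil V r hr hkr ψ hψ W τ hτ pτ cW hcW)
    (Deformation.AtlasRefinementQuot.refineGluing halg₀ hJnil V' r' hr' hkr' ψ' hψ' W τ' hτ' pτ' cW hcW)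
    (Deformation.AtlasRefinementQuot.reduction_refineGluing halg₀ hJnil V' r' hr' hkr' ψ' hψ' W τ' hτ' pτ' cW hcW)
    δ₁ δ₂ hδ₁ hδ₂ ho₁ ho₂r
    (refineMC2_mem_cechMZ2 _ _ _ _ τ (fun j => (closedFibreι hJ X₀).preimage_mono (hτ j)) ho₂)
    (refineMC2_mem_cechMZ2 _ _ _ _ τ' (fun j => (closedFibreι hJ X₀).preimage_mono (hτ' j)) ho₂')
  /- (4) CONCLUSION: `[ρ_τ o] = 0` as `[o] = 0` (e3, easy direction); hence `[ρ_τ' o'] = 0`; and `Ȟ²(pr₁⁻¹𝒱′; 𝒯) → Ȟ²(pr₁⁻¹𝒲; 𝒯)` is injective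
  for the AFFINE trace cover `pr₁⁻¹V′` and the affine-localizing `𝒯_{X_κ/κ}` (`𝒯` finite locally free on the abelian variety `X_κ`). -/
  have hz₁ := Deformation.AtlasRefinementQuot.cechMH2_mk_refine_eq_zero (i := closedFibreι hJ X₀) (V := V) (V' := W) (τ := τ) (hτ := hτ)
    ho₂ h0
  have hT : IsAffineLocalizing (tangentSheaf (closedFibre hJ X₀).X) :=
    IsFiniteLocallyFree.isAffineLocalizing
      (Motives.AbelianVariety.isFiniteLocallyFree_tangentSheaf (closedFibre hJ X₀).toAffine.toAbelianVariety)
  exact Deformation.AtlasRefinementQuot.cechMH2_mk_eq_zero_of_refine (i := closedFibreι hJ X₀) (V := V') (hiV := hiV') (V' := W) (τ := τ')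
    (hτ := hτ') hT hW ho₂' (key.trans hz₁)

/-! ## §3 (g2) The criterion as an `iff` -/

/-- **(g2) `LiftObstructionVanishes` ⇔ ONE datum of the letters has class zero** (§1 for «→», §2 for «←»; `.mpr` = the `∃`-form of (g1)).
[cite: Oort1971, §2.2 (pp. 277–280)] [cite: Hartshorne2010, Thm. 10.2 (a) (proof), p. 81] -/
theorem liftObstructionVanishes_iff_exists_atlas_classZero (hJ : J ≠ ⊤) (hmJ : IsLocalRing.maximalIdeal A * J = ⊥)
    (φ : ↥J ≃ₗ[A] IsLocalRing.ResidueField A) (X₀ : AbelianSchemeOver (Spec (.of (A ⧸ J)))) :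
    LiftObstructionVanishes hJ hmJ φ X₀ ↔
    letI : ∀ W : X₀.X.left.Opens, Algebra A Γ(X₀.X.left, W) := fun W =>
      (((Scheme.ΓSpecIso (.of (A ⧸ J))).inv ≫ X₀.X.hom.appLE ⊤ W le_top).hom.comp (Ideal.Quotient.mk J)).toAlgebra
    ∃ (n : ℕ) (V : Fin n → X₀.X.left.affineOpens) (c : (a b : Fin n) → Γ(X₀.X.left, (V a).1))
      (P : Fin n → Type) (_ : ∀ a, CommRing (P a)) (_ : ∀ a, Algebra A (P a)) (_ : ∀ a, Algebra.IsStandardSmooth A (P a))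
      (_ : ∀ a, Module.Flat A (P a))
      (r : (a : Fin n) → P a →ₐ[A] Γ(X₀.X.left, (V a).1))
      (ψ : (a b : Fin n) → chartLift V r a (inf_le_left : (V a).1 ⊓ (V b).1 ≤ (V a).1) ≃ₐ[A]
        chartLift V r b (inf_le_right : (V a).1 ⊓ (V b).1 ≤ (V b).1))
      (_ : ⨆ a, (V a).1 = ⊤) (hc : ∀ a b, (V a).1 ⊓ (V b).1 = X₀.X.left.basicOpen (c a b))
      (hr : ∀ a, Function.Surjective (r a)) (hkr : ∀ a, RingHom.ker (r a) = J.map (algebraMap A (P a)))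
      (hψ : ∀ a b x, reduction (r b) (res (inf_le_right : (V a).1 ⊓ (V b).1 ≤ (V b).1))
          (halg_of_structureMorphism X₀.X.hom _ _ _) (ψ a b x) =
        reduction (r a) (res (inf_le_left : (V a).1 ⊓ (V b).1 ≤ (V a).1)) (halg_of_structureMorphism X₀.X.hom _ _ _) x)
      (_ : ∀ W : (closedFibre hJ X₀).X.left.Opens, Algebra A Γ((closedFibre hJ X₀).X.left, W))
      (π : (W : X₀.X.left.Opens) → Γ(X₀.X.left, W) →ₐ[A]
        Γ((closedFibre hJ X₀).X.left, (closedFibreι hJ X₀) ⁻¹ᵁ W))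
      (hπ : ∀ (a : Fin n) (W : X₀.X.left.Opens), W ≤ (V a).1 → (∃ q : Γ(X₀.X.left, (V a).1), W = X₀.X.left.basicOpen q) →
        Function.Surjective (π W) ∧ RingHom.ker (π W) = (IsLocalRing.maximalIdeal A).map (algebraMap A Γ(X₀.X.left, W)))
      (δ : (a b d : Fin n) → Derivation A
        Γ((closedFibre hJ X₀).X.left, (closedFibreι hJ X₀) ⁻¹ᵁ ((V a).1 ⊓ (V b).1 ⊓ (V d).1))
        (Γ((closedFibre hJ X₀).X.left, (closedFibreι hJ X₀) ⁻¹ᵁ ((V a).1 ⊓ (V b).1 ⊓ (V d).1)) ⊗[A] ↥J))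
      (_ : ∀ a b d, readingAut (halg_of_structureMorphism X₀.X.hom) (LiftedLaw.isNilpotent_of_ne_top hJ) V r hr hkr
          (IsLocalRing.maximalIdeal A) π hπ hmJ (IsLocalRing.le_maximalIdeal hJ) a (inf_le_left.trans inf_le_left)
          ⟨_, inf₃_eq_basicOpen₁ V c hc a b d⟩ (δ a b d) =
        disc (halg_of_structureMorphism X₀.X.hom) (LiftedLaw.isNilpotent_of_ne_top hJ) V c hc r hr hkr ψ hψ a b d)
      (_ : ∀ (W : (closedFibre hJ X₀).X.left.Opens) (a : A), algebraMap A Γ((closedFibre hJ X₀).X.left, W) a =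
        (constToPresheaf (closedFibre hJ X₀).X).app (op W) (algebraMap A (IsLocalRing.ResidueField A) a))
      (_ : ∀ (W : X₀.X.left.Opens) (x : Γ(X₀.X.left, W)), π W x = (closedFibreι hJ X₀).app W x)
      (_ : ∀ a, IsAffineOpen ((closedFibreι hJ X₀) ⁻¹ᵁ (V a).1))
      (_ : ∀ ⦃W W' : X₀.X.left.Opens⦄ (h : W' ≤ W) (x : Γ(X₀.X.left, W)),
        (closedFibre hJ X₀).X.left.presheaf.map
          (homOfLE ((closedFibreι hJ X₀).preimage_mono h)).op (π W x) = π W' (res h x))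
      (o : CechMC2 (closedFibre hJ X₀).X.hom (tangentSheaf (closedFibre hJ X₀).X) (fun a => (closedFibreι hJ X₀) ⁻¹ᵁ (V a).1))
      (_ : ∀ (a b d : Fin n) (x : Γ((closedFibre hJ X₀).X.left, (closedFibreι hJ X₀) ⁻¹ᵁ (V a).1 ⊓ (closedFibreι hJ X₀) ⁻¹ᵁ (V b).1 ⊓ (closedFibreι hJ X₀) ⁻¹ᵁ (V d).1)),
        δ a b d x = (show Γ((closedFibre hJ X₀).X.left, (closedFibreι hJ X₀) ⁻¹ᵁ (V a).1 ⊓ (closedFibreι hJ X₀) ⁻¹ᵁ (V b).1 ⊓ (closedFibreι hJ X₀) ⁻¹ᵁ (V d).1) from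
          appLE (o a b d) (𝟙 _) (dSection (closedFibre hJ X₀).X _ x)) ⊗ₜ φ.symm 1)
      (ho₂ : o ∈ cechMZ2 (closedFibre hJ X₀).X.hom (tangentSheaf (closedFibre hJ X₀).X) (fun a => (closedFibreι hJ X₀) ⁻¹ᵁ (V a).1)),
      CechMH2.mk (closedFibre hJ X₀).X.hom (tangentSheaf (closedFibre hJ X₀).X) (fun a => (closedFibreι hJ X₀) ⁻¹ᵁ (V a).1) ⟨o, ho₂⟩ = 0 := by
  refine ⟨exists_liftAtlasDatum_classZero_of_liftObstructionVanishes hJ hmJ φ X₀, ?_⟩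
  rintro ⟨n, V, c, P, _, _, _, _, r, ψ, hV, hc, hr, hkr, hψ, _, π, hπ, δ, hδ, halgκ, hπi, hiV, hπnat, o, ho, ho₂, h0⟩
  exact liftObstructionVanishes_of_atlas_classZero hJ hmJ φ X₀ n V c P r ψ hV hc hr hkr hψ π hπ δ hδ halgκ hπi hiV hπnat o ho ho₂ h0

end Literature.AlgebraicGeometry.AbelianSchemes.AbelianSchemeOver

end
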